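import Literature.MathematicalPhysics.QuantumLattice.LayeredThermalEnergyWindows
import Literature.MathematicalPhysics.QuantumLattice.VariationalEquilibriumCoexistence
import HarnessLib

/-!
# Simple tetragonal stacking at `T > 0`: the layered `t–t'` Hubbard crystal with ONE vertical hopping `t_z` — the headline windows of the
# layered variational-pressure files with `Σ_b|tz_b| = |t_z|`, stated without the interlayer-pattern bookkeeping

Topic `Literature/MathematicalPhysics/QuantumLattice` (family `hubbard`; crew hubbard-fast S2, D-0096 (iii) interlayer coupling at `T > 0`). The
`T = 0` instance is `tiGroundEnergyDensityAt_verticalHubbardTTPrime_mem_Icc(_sharp)`; here the `T > 0` instances (interlayer vector `e₀ = (1,0,0)`,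
amplitude `t_z`, range `R' = 1`), for consumers who want to cite ONE theorem with numbers `(β, t, t', U, μ/ρ, t_z)`:

* `verticalHubbardTTPrime t t' U tz` / `gcVerticalHubbardTTPrime t t' U μ hz tz` — abbreviations (no new content) for
  `layeredHubbardTTPrime … (fun _ : Fin 1 => e₀) (fun _ => tz)` and its grand-canonical dressing;
* **GC pressure sandwich** `P_3 ∈ [gcPressureTT'Zeeman, gcPressureTT'Zeeman + β(4/π)|t_z|]` (`varPressure_gcVertical_mem_Icc`);
* **canonical sandwich** `P_3(·;ρ) ∈ [pressureTT' ρ, pressureTT' ρ + β(4/π)|t_z|]` (`varPressureAt_vertical_mem_Icc`);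
* **density / magnetisation of 3D thermal states** from three 2D GC pressures, slack `β(4/π)|t_z|` (`…density_mem_Icc_of_gcVertical`,
  `…spinImbalance_mem_Icc_of_gcVertical`), and the **density jump of coexisting 3D phases** (`…abs_density_sub_le_of_gcVertical_mix`);
* **thermal docc** and **thermal energy** of 3D states of density `ρ` from three 2D CANONICAL pressures (`…docc_mem_Icc_of_approxAt_vertical`,
  `…meanEnergy_vertical_mem_Icc_pressureTT'`).

Everything is PROVED (specialisations); the two abbreviations are `def`s with bodies; no named fact, no number.

## Mathlib / tree search

REUSED: everything from `LayeredHubbardGrandCanonicalVariationalPressure`, `CanonicalVariationalPressure`, `VariationalEquilibriumCoexistence`,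
`LayeredThermalEnergyWindows`; `unitVec_zero_apply_zero_ne_zero`, `unitVec_mem_thicken_one` (`LayeredLatticeEnergyTransport`, `HubbardFermionInteractionTerms`).

## References

* O. Bratteli, A. Kishimoto, D. W. Robinson, Commun. Math. Phys. 64 (1978) 41, Thm. 2. [cite: BratteliKishimotoRobinson1978, Thm. 2 (condition 2)]
* E. Pavarini et al., Phys. Rev. Lett. 87 (2001) 047003, eq. (1) (one-band models of layered cuprates; `t_⊥`). [cite: PavariniEtAl2001, eq. (1)]
-/

noncomputable section

open scoped ComplexOrder BigOperators
open Finset Literature.InformationTheory.Entropy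

namespace Literature.MathematicalPhysics.QuantumLattice

open Matrix HubbardWave0 Literature.Probability.LatticeModels ThermodynamicLimit

/-- **The simple-tetragonal layered `t–t'` Hubbard crystal**: one vertical hopping `t_z` along `e₀ = (1,0,0)`. [cite: PavariniEtAl2001, eq. (1)] -/
def verticalHubbardTTPrime (t t' U tz : ℝ) : FermionInteraction 3 :=
  layeredHubbardTTPrime t t' U (fun _ : Fin 1 => (unitVec (0 : Fin 3) : Site 3)) fun _ => tz

/-- **Its grand-canonical dressing** `Φ − μn − h(n↑ − n↓)`. [cite: PavariniEtAl2001, eq. (1)] [cite: ArakiMoriya2003, §5.1] -/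
def gcVerticalHubbardTTPrime (t t' U μ hz tz : ℝ) : FermionInteraction 3 :=
  gcLayeredHubbardTTPrime t t' U μ hz (fun _ : Fin 1 => (unitVec (0 : Fin 3) : Site 3)) fun _ => tz

/-- The vertical pattern: `(e₀)₀ ≠ 0`. [cite: PavariniEtAl2001, eq. (1)] -/
private theorem vertical_w0 : ∀ _b : Fin 1, ((fun _ : Fin 1 => (unitVec (0 : Fin 3) : Site 3)) _b) 0 ≠ 0 :=
  fun _ => unitVec_zero_apply_zero_ne_zero

/-- The vertical pattern lies in the unit range box. [cite: PavariniEtAl2001, eq. (1)] -/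
private theorem vertical_wR : ∀ _b : Fin 1, (fun _ : Fin 1 => (unitVec (0 : Fin 3) : Site 3)) _b ∈ thicken ({0} : Finset (Site 3)) 1 :=
  fun _ => unitVec_mem_thicken_one 0

/-- `Σ_b |tz_b| = |t_z|` for the one-vector pattern. [cite: PavariniEtAl2001, eq. (1)] -/
private theorem vertical_sum (tz : ℝ) : ∑ _b : Fin 1, |(fun _ : Fin 1 => tz) _b| = |tz| := by simp

/-- **GC PRESSURE SANDWICH, simple tetragonal** (`β ≥ 0`, `U ≥ 0`):
`P_3(β, gcVertical(t,t',U,μ,h,t_z)) ∈ [gcPressureTT'Zeeman β t t' U μ h, gcPressureTT'Zeeman β t t' U μ h + β(4/π)|t_z|]`.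
[cite: BratteliKishimotoRobinson1978, Thm. 2 (condition 2)] -/
theorem varPressure_gcVertical_mem_Icc {β : ℝ} (hβ : 0 ≤ β) (t t' : ℝ) {U : ℝ} (hU : 0 ≤ U) (μ hz tz : ℝ) :
    (gcVerticalHubbardTTPrime t t' U μ hz tz).varPressure β 1 ∈
      Set.Icc (gcPressureTT'Zeeman β t t' U μ hz) (gcPressureTT'Zeeman β t t' U μ hz + β * (4 / Real.pi * |tz|)) := by
  have h := varPressure_gcLayeredHubbardTTPrime_mem_Icc_gcPressureTT'Zeeman hβ t t' hU μ hz vertical_w0 (fun _ => tz) le_rfl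
    vertical_wR
  rw [vertical_sum] at h
  exact h

/-- **CANONICAL SANDWICH, simple tetragonal** (`β > 0`, `U ≥ 0`, `0 < ρ < 2`):
`P_3(β, vertical; ρ) ∈ [pressureTT' β t t' U ρ, pressureTT' β t t' U ρ + β(4/π)|t_z|]`. [cite: BratteliKishimotoRobinson1978, Thm. 2 (condition 2)] -/
theorem varPressureAt_vertical_mem_Icc {β : ℝ} (hβ : 0 < β) (t t' : ℝ) {U : ℝ} (hU : 0 ≤ U) (tz : ℝ) {ρ : ℝ} (hρ0 : 0 < ρ)
    (hρ2 : ρ < 2) :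
    (verticalHubbardTTPrime t t' U tz).varPressureAt β 1 ρ ∈
      Set.Icc (pressureTT' β t t' U ρ) (pressureTT' β t t' U ρ + β * (4 / Real.pi * |tz|)) := by
  have h := varPressureAt_layeredHubbardTTPrime_mem_Icc_pressureTT' hβ t t' hU vertical_w0 (fun _ => tz) le_rfl vertical_wR
    hρ0 hρ2
  rw [vertical_sum] at h
  exact h

/-- **DENSITY of 3D thermal states, simple tetragonal** (`β > 0`, `U ≥ 0`, `δ > 0`; `P = gcPressureTT'Zeeman β t t' U · h`):
`ρ(ω) ∈ [(P(μ) − P(μ−δ) − β(4/π)|t_z|)/(βδ), (P(μ+δ) − P(μ) + β(4/π)|t_z|)/(βδ)]`. [cite: Griffiths1964, Eq. (39) and Fig. 3] -/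
theorem InfVolFermionState.IsVarEquilibrium.density_mem_Icc_of_gcVertical {β : ℝ} (hβ : 0 < β) (t t' : ℝ) {U : ℝ} (hU : 0 ≤ U)
    (μ hz tz : ℝ) {ω : InfVolFermionState 3} (hω : ω.IsVarEquilibrium β (gcVerticalHubbardTTPrime t t' U μ hz tz) 1)
    {δ : ℝ} (hδ : 0 < δ) :
    ω.density ∈ Set.Icc
      ((gcPressureTT'Zeeman β t t' U μ hz - gcPressureTT'Zeeman β t t' U (μ - δ) hz - β * (4 / Real.pi * |tz|)) / (β * δ))
      ((gcPressureTT'Zeeman β t t' U (μ + δ) hz - gcPressureTT'Zeeman β t t' U μ hz + β * (4 / Real.pi * |tz|)) / (β * δ)) := by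
  have h := hω.density_mem_Icc_of_gcLayered hβ t t' hU μ hz vertical_w0 (fun _ => tz) le_rfl vertical_wR hδ
  rw [vertical_sum] at h
  exact h

/-- **MAGNETISATION of 3D thermal states, simple tetragonal** (`P = gcPressureTT'Zeeman β t t' U μ ·`).
[cite: Griffiths1964, Eq. (39) and Fig. 3] -/
theorem InfVolFermionState.IsVarEquilibrium.spinImbalance_mem_Icc_of_gcVertical {β : ℝ} (hβ : 0 < β) (t t' : ℝ) {U : ℝ}
    (hU : 0 ≤ U) (μ hz tz : ℝ) {ω : InfVolFermionState 3} (hω : ω.IsVarEquilibrium β (gcVerticalHubbardTTPrime t t' U μ hz tz) 1)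
    {δ : ℝ} (hδ : 0 < δ) :
    ω.meanEnergy (spinImbalanceInteraction 3) 1 ∈ Set.Icc
      ((gcPressureTT'Zeeman β t t' U μ hz - gcPressureTT'Zeeman β t t' U μ (hz - δ) - β * (4 / Real.pi * |tz|)) / (β * δ))
      ((gcPressureTT'Zeeman β t t' U μ (hz + δ) - gcPressureTT'Zeeman β t t' U μ hz + β * (4 / Real.pi * |tz|)) / (β * δ)) := by
  have h := hω.spinImbalance_mem_Icc_of_gcLayered hβ t t' hU μ hz vertical_w0 (fun _ => tz) le_rfl vertical_wR hδ
  rw [vertical_sum] at h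
  exact h

/-- **DENSITY JUMP of coexisting 3D phases, simple tetragonal**:
`|ρ(ω₁) − ρ(ω₂)| ≤ (P(μ+δ) + P(μ−δ) − 2P(μ) + 2β(4/π)|t_z|)/(βδ)`. [cite: Griffiths1964, Eq. (39) and Fig. 3] -/
theorem InfVolFermionState.IsVarEquilibrium.abs_density_sub_le_of_gcVertical_mix {β : ℝ} (hβ : 0 < β) (t t' : ℝ) {U : ℝ}
    (hU : 0 ≤ U) (μ hz tz : ℝ) {ω₁ ω₂ : InfVolFermionState 3} (hω₁ : ω₁.IsTranslationInvariant) (hω₂ : ω₂.IsTranslationInvariant)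
    {s : ℝ} {hs₀ : 0 ≤ s} {hs₁ : s ≤ 1} (hs0 : 0 < s) (hs1 : s < 1)
    (h : (InfVolFermionState.mix s hs₀ hs₁ ω₁ ω₂).IsVarEquilibrium β (gcVerticalHubbardTTPrime t t' U μ hz tz) 1) {δ : ℝ}
    (hδ : 0 < δ) :
    |ω₁.density - ω₂.density| ≤
      (gcPressureTT'Zeeman β t t' U (μ + δ) hz + gcPressureTT'Zeeman β t t' U (μ - δ) hz - 2 * gcPressureTT'Zeeman β t t' U μ hz +
        2 * (β * (4 / Real.pi * |tz|))) / (β * δ) := by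
  have h' := InfVolFermionState.IsVarEquilibrium.abs_density_sub_le_of_gcLayered_mix hβ t t' hU μ hz vertical_w0 (fun _ => tz)
    le_rfl vertical_wR hω₁ hω₂ hs0 hs1 h hδ
  rw [vertical_sum] at h'
  exact h'

/-- **THERMAL DOCC of 3D states of density `ρ`, simple tetragonal, from three 2D canonical pressures** (`β > 0`, `δ > 0`, `U − δ ≥ 0`,
`0 < ρ < 2`; `p(·) = pressureTT' β t t' · ρ`, `ε = ε' + β(4/π)|t_z|`). [cite: Griffiths1964, Eq. (39) and Fig. 3] -/
theorem InfVolFermionState.IsTranslationInvariant.docc_mem_Icc_of_approxAt_vertical {β : ℝ} (hβ : 0 < β) (t t' : ℝ) {U δ : ℝ}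
    (hδ : 0 < δ) (hUδ : 0 ≤ U - δ) (tz : ℝ) {ρ : ℝ} (hρ0 : 0 < ρ) (hρ2 : ρ < 2) {ω : InfVolFermionState 3}
    (hω : ω.IsTranslationInvariant) (hωρ : ω.density = ρ) {ε' : ℝ}
    (happ : (verticalHubbardTTPrime t t' U tz).varPressureAt β 1 ρ - ε' ≤
      ω.entropyDensitySup - β * ω.meanEnergy (verticalHubbardTTPrime t t' U tz) 1) :
    ω.meanEnergy (hubbardFermionInteraction 3 0 1) 1 ∈ Set.Icc
      ((pressureTT' β t t' U ρ - pressureTT' β t t' (U + δ) ρ - (ε' + β * (4 / Real.pi * |tz|))) / (β * δ))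
      ((pressureTT' β t t' (U - δ) ρ - pressureTT' β t t' U ρ + (ε' + β * (4 / Real.pi * |tz|))) / (β * δ)) := by
  have h := hω.docc_mem_Icc_of_approxAt_layeredHubbardTTPrime hβ t t' hδ hUδ vertical_w0 (fun _ => tz) le_rfl vertical_wR hρ0 hρ2
    hωρ happ
  rw [vertical_sum] at h
  exact h

/-- **THERMAL ENERGY of 3D states of density `ρ`, simple tetragonal, from three 2D canonical pressures at `β−δ, β, β+δ`**
(`0 < δ < β`, `U ≥ 0`, `0 < ρ < 2`; `ε = ε' + β(4/π)|t_z|`):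
`e_3(ω) ∈ [(p(β) − p(β+δ) − ε)/δ − (4/π)|t_z|, (p(β−δ) − p(β) + ε)/δ + (4/π)|t_z|]`. [cite: Israel1979, Thm. I.2.4] -/
theorem InfVolFermionState.IsTranslationInvariant.meanEnergy_vertical_mem_Icc_pressureTT' {β δ : ℝ} (hδ : 0 < δ) (hδβ : δ < β)
    (t t' : ℝ) {U : ℝ} (hU : 0 ≤ U) (tz : ℝ) {ρ : ℝ} (hρ0 : 0 < ρ) (hρ2 : ρ < 2) {ω : InfVolFermionState 3}
    (hω : ω.IsTranslationInvariant) (hωρ : ω.density = ρ) {ε' : ℝ}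
    (happ : (verticalHubbardTTPrime t t' U tz).varPressureAt β 1 ρ - ε' ≤
      ω.entropyDensitySup - β * ω.meanEnergy (verticalHubbardTTPrime t t' U tz) 1) :
    ω.meanEnergy (verticalHubbardTTPrime t t' U tz) 1 ∈
      Set.Icc ((pressureTT' β t t' U ρ - pressureTT' (β + δ) t t' U ρ - (ε' + β * (4 / Real.pi * |tz|))) / δ - 4 / Real.pi * |tz|)
        ((pressureTT' (β - δ) t t' U ρ - pressureTT' β t t' U ρ + (ε' + β * (4 / Real.pi * |tz|))) / δ + 4 / Real.pi * |tz|) := by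
  have h := hω.meanEnergy_layered_mem_Icc_pressureTT' hδ hδβ t t' hU vertical_w0 (fun _ => tz) le_rfl vertical_wR hρ0 hρ2 hωρ happ
  rw [vertical_sum] at h
  exact h

end Literature.MathematicalPhysics.QuantumLattice

end
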